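import Summits.Parity.BatemanHorn.Theorems.SoloInformedThinRows
import HarnessLib

/-!
# Thin sequences vs. Type-I/II information, XX: Type II above the co-density (good rows)

The Type-II companion of `SoloInformedThinRows`.  Testing Ford–Maynard's bilinear condition (II)
[cite: FordMaynard2024PrimeSieves, §1 (II)] with `ξ = 1_{good primes p ≍ x^e}` (no multiple of
`p` in `(x/2, x]` carries a value of `a`) and `κ = 1` weighs the full `b`-mass of those rows; if
`a` has at most `x^{1−c}` non-zero values on `(x/2, x]` and `e > 1 − c`, almost every prime
`p ≍ x^e` is good (`typeII_sparse_le_rows`).  Hence (`eventually_not_typeII_of_sparse_rows`): for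
`0 ≤ θ < 1`, `ν > 0`, `θ + ν > 1 − c`, `κ > max(θ, 1 − c)`, no `b ≥ 0` with prime-multiple mass
`≥ x/(4p)` for the primes `(x/2)^θ < p ≤ x^κ` outside an exceptional set of `≤ (log x)²` primes
lets `a − b` satisfy (II) in `[θ, θ + ν]` — no height and no column condition.  Together with
`eventually_not_typeII_of_sparse_col` (`θ < c`, `SoloInformedThinColumns`): a Type-II window of a
support of size `x^{1−c}` must satisfy `c ≤ θ < θ + ν ≤ 1 − c` (empty for `c ≥ 1/2`).
`…_coprime`: the `(n, q) = 1` twist, `Q =` prime divisors of `q ≤ x²`.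
-/

noncomputable section

open Filter Finset Real

namespace Summit.Parity.BatemanHorn.Theorems

open Literature.Barriers.Parity.FordMaynard (TypeII eventually_mul_rpow_le_rpow)

/-- **(II) against a thin support — good rows only.**  Let `S` be a finite set of primes `p > M`
inside the Type-II window `((x/2)^θ, x^{θ+ν}]`, `A ⊇` the support of `a` on `(x/2, x]`, `b ≥ 0`
with `∑_{x/2 < pn ≤ x} b(pn) ≥ m` for EVERY `p ∈ S` (no height, no column condition).  Testing
(II) for `w = a − b` with `ξ = 1_{good primes}` (no multiple in the support), `κ = 1`:
`(#S − #A · log x / log M) · m ≤ x/(log x)^B`. [cite: FordMaynard2024PrimeSieves, §2.4] -/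
theorem typeII_sparse_le_rows {a b : ℕ → ℝ} {x θ ν B m : ℝ} (hB : 0 ≤ B) (hx : 1 ≤ x) {M : ℝ}
    (hM : 1 < M) (S A : Finset ℕ)
    (hS : ∀ p ∈ S, p.Prime ∧ M < (p : ℝ) ∧ (x / 2) ^ θ < (p : ℝ) ∧ (p : ℝ) ≤ x ^ (θ + ν))
    (hA : ∀ v : ℕ, x / 2 < (v : ℝ) → (v : ℝ) ≤ x → a v ≠ 0 → v ∈ A)
    (hb0 : ∀ n, 0 ≤ b n) (hm : 0 ≤ m)
    (hmass : ∀ p ∈ S, m ≤ ∑ n ∈ (Icc 1 ⌊x⌋₊).filter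
        (fun n : ℕ => x / 2 < (p * n : ℝ) ∧ (p * n : ℝ) ≤ x), b (p * n))
    (h : TypeII (fun n : ℕ => a n - b n) x θ ν B) :
    ((S.card : ℝ) - A.card * (Real.log x / Real.log M)) * m ≤ x / Real.log x ^ B := by
  set L := Real.log x / Real.log M with hL
  set T : Finset ℕ := Icc 1 ⌊x⌋₊ with hTdef
  set Nw : ℕ → Finset ℕ := fun p : ℕ =>
    T.filter (fun n : ℕ => x / 2 < (p * n : ℝ) ∧ (p * n : ℝ) ≤ x) with hNw
  set W : Finset ℕ :=
    (Icc 1 ⌊x ^ (θ + ν)⌋₊).filter (fun m : ℕ => (x / 2) ^ θ < (m : ℝ)) with hW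
  -- bad primes `Sb` (some cofactor carries a non-zero value of `a`) and good primes `Sg`
  set Sb : Finset ℕ := S.filter (fun p : ℕ => ∃ r : ℕ, r ∈ T ∧
      (x / 2 < (p * r : ℝ) ∧ (p * r : ℝ) ≤ x) ∧ a (p * r) ≠ 0) with hSb
  set Sg : Finset ℕ := S.filter (fun p : ℕ => ¬ ∃ r : ℕ, r ∈ T ∧
      (x / 2 < (p * r : ℝ) ∧ (p * r : ℝ) ≤ x) ∧ a (p * r) ≠ 0) with hSg
  have hS' : ∀ p ∈ S, p.Prime ∧ M < (p : ℝ) := fun p hp => ⟨(hS p hp).1, (hS p hp).2.1⟩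
  have hSgS : Sg ⊆ S := by rw [hSg]; exact filter_subset _ _
  have hSgW : Sg ⊆ W := by
    intro p hp
    obtain ⟨hpr, _, h1, h2⟩ := hS p (hSgS hp)
    rw [hW, Finset.mem_filter, mem_Icc]
    exact ⟨⟨hpr.one_le, Nat.le_floor h2⟩, h1⟩
  have hx0 : 0 < x := by linarith
  -- good rows carry no value of `a`
  have hfg : ∀ m n : ℕ, m ∈ Sg → True → x / 2 < (m * n : ℝ) → (m * n : ℝ) ≤ x →
      a (m * n) = 0 := by
    intro m n hm _ h1 h2
    have hm' := hm
    simp only [hSg, Finset.mem_filter] at hm'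
    obtain ⟨hmS, hg⟩ := hm'
    by_contra hne
    apply hg
    refine ⟨n, ?_, ⟨h1, h2⟩, hne⟩
    have hm1 : (1 : ℝ) ≤ m := by exact_mod_cast (hS' m hmS).1.one_le
    have hn0 : n ≠ 0 := by
      rintro rfl
      rw [Nat.cast_zero, mul_zero] at h1
      linarith
    have hnx : (n : ℝ) ≤ x := by
      have : (n : ℝ) ≤ m * n := le_mul_of_one_le_left (Nat.cast_nonneg _) hm1
      linarith
    rw [hTdef, mem_Icc]
    exact ⟨Nat.one_le_iff_ne_zero.mpr hn0, Nat.le_floor hnx⟩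
  have hT : ∑ m ∈ W, ∑ n ∈ (Nw m).filter (fun n : ℕ => m ∈ Sg ∧ True), b (m * n) ≤
      x / Real.log x ^ B :=
    typeII_zero_pairs_sum_le hB (fun m : ℕ => m ∈ Sg) (fun _ : ℕ => True) hb0 hfg h
  have h1 : ∑ p ∈ Sg, ∑ n ∈ Nw p, b (p * n) ≤ x / Real.log x ^ B :=
    calc ∑ p ∈ Sg, ∑ n ∈ Nw p, b (p * n)
        = ∑ p ∈ Sg, ∑ n ∈ (Nw p).filter (fun n : ℕ => p ∈ Sg ∧ True), b (p * n) := by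
          refine sum_congr rfl fun p hp => ?_
          rw [Finset.filter_true_of_mem (fun n _ => ⟨hp, trivial⟩)]
      _ ≤ ∑ m ∈ W, ∑ n ∈ (Nw m).filter (fun n : ℕ => m ∈ Sg ∧ True), b (m * n) :=
          sum_le_sum_of_subset_of_nonneg hSgW (fun _ _ _ => sum_nonneg fun _ _ => hb0 _)
      _ ≤ x / Real.log x ^ B := hT
  -- bad primes: at most `#A · L` of them
  have h2 : (Sb.card : ℝ) ≤ A.card * L :=
    card_badPrimes_le hx hM S T A Sb hS' hA (fun p hp => by
      have hp' := hp
      simp only [hSb, Finset.mem_filter] at hp'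
      exact hp')
  have hcardSg : (Sg.card : ℝ) = S.card - Sb.card := by
    have hsplit := Finset.card_filter_add_card_filter_not (s := S) (fun p : ℕ => ∃ r : ℕ,
      r ∈ T ∧ (x / 2 < (p * r : ℝ) ∧ (p * r : ℝ) ≤ x) ∧ a (p * r) ≠ 0)
    have : (Sb.card : ℝ) + Sg.card = S.card := by
      rw [hSb, hSg]; exact_mod_cast hsplit
    linarith
  have h3 : (Sg.card : ℝ) * m ≤ ∑ p ∈ Sg, ∑ n ∈ Nw p, b (p * n) := by
    rw [← nsmul_eq_mul, ← sum_const]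
    exact sum_le_sum fun p hp => hmass p (hSgS hp)
  have h4 : ((S.card : ℝ) - A.card * L) * m ≤ (Sg.card : ℝ) * m := by
    apply mul_le_mul_of_nonneg_right _ hm
    linarith
  linarith

/-- Bookkeeping: `x^{1-c} · 2L₁ ≤ M/(4 K L₂)` once `L₁, L₂ ≤ x^δ`, `16 K x^{(1-c)+2δ} ≤ x^e ≤ M`.
[folklore] -/
theorem rpow_mul_log_le_div_log {x K c δ e M L₁ L₂ : ℝ} (hx : 0 < x) (hK : 0 < K)
    (h₂ : 0 < L₂) (hL₁ : L₁ ≤ x ^ δ) (hL₂ : L₂ ≤ x ^ δ)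
    (he : 16 * K * x ^ ((1 - c) + δ + δ) ≤ x ^ e) (hM : x ^ e ≤ M) :
    x ^ (1 - c) * (2 * L₁) ≤ M / (4 * K * L₂) := by
  rw [le_div_iff₀ (by positivity)]
  have hl2 : L₁ * L₂ ≤ x ^ δ * x ^ δ := mul_le_mul hL₁ hL₂ h₂.le (Real.rpow_nonneg hx.le _)
  have hprod : x ^ (1 - c) * x ^ δ * x ^ δ = x ^ ((1 - c) + δ + δ) := by
    rw [← Real.rpow_add hx, ← Real.rpow_add hx]
  have hnn : 0 ≤ x ^ (1 - c) := Real.rpow_nonneg hx.le _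
  calc x ^ (1 - c) * (2 * L₁) * (4 * K * L₂)
        = 8 * K * (x ^ (1 - c) * (L₁ * L₂)) := by ring
    _ ≤ 8 * K * (x ^ (1 - c) * (x ^ δ * x ^ δ)) :=
        mul_le_mul_of_nonneg_left (mul_le_mul_of_nonneg_left hl2 hnn) (by positivity)
    _ = (16 * K * x ^ ((1 - c) + δ + δ)) / 2 := by rw [← hprod]; ring
    _ ≤ M := by
        have : 0 ≤ 16 * K * x ^ ((1 - c) + δ + δ) := by positivity
        linarith

/-- Bookkeeping: `x/(32 K log x) ≤ (s/2) · x/(8M)` once `M/(2K log 2M) ≤ s`, `log 2M ≤ log x`.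
[folklore] -/
theorem div_log_le_half_mul_div {x K M s : ℝ} (hx : 0 < x) (hK : 0 < K) (hM : 0 < M)
    (hlx : 0 < Real.log x) (hl0 : 0 < Real.log (2 * M)) (hl : Real.log (2 * M) ≤ Real.log x)
    (hs : M / (2 * K * Real.log (2 * M)) ≤ s) :
    x / (8 * (4 * K) * Real.log x) ≤ s / 2 * (x / (8 * M)) := by
  have hMK : M / (2 * K * Real.log x) ≤ s :=
    le_trans (div_le_div_of_nonneg_left hM.le (by positivity)
      (mul_le_mul_of_nonneg_left hl (by positivity))) hs
  have hMne : M ≠ 0 := hM.ne'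
  have hlxne : Real.log x ≠ 0 := hlx.ne'
  have hKne : K ≠ 0 := hK.ne'
  calc x / (8 * (4 * K) * Real.log x)
        = M / (2 * K * Real.log x) / 2 * (x / (8 * M)) := by
        field_simp
        try ring
    _ ≤ s / 2 * (x / (8 * M)) := by
        apply mul_le_mul_of_nonneg_right _ (by positivity)
        linarith

set_option maxHeartbeats 400000 in
/-- **No Type-II information ABOVE the co-density — no height, no column condition.**  Let
`0 < c`, `0 ≤ θ < 1`, `ν > 0`, `θ + ν > 1 − c`, `κ > max(θ, 1 − c)`, `B > 1`.  For all large `x`: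
for no real `a` with at most `x^{1−c}` non-zero values on `(x/2, x]`, no exceptional set `Q` of at
most `(log x)²` primes and no `b ≥ 0` with `∑_{x/2 < pn ≤ x} b(pn) ≥ x/(4p)` for every prime
`(x/2)^θ < p ≤ x^κ`, `p ∉ Q`, does `w = a − b` satisfy (II) in `[θ, θ + ν]`.  (Rows of the primes
`p ≍ x^e`, `max(θ, 1 − c) < e < min(κ, θ + ν, 1)`: more rows than elements of the support.)  With
`eventually_not_typeII_of_sparse_col` (`θ < c`): a Type-II window of a support of size `x^{1−c}`
must satisfy `c ≤ θ < θ + ν ≤ 1 − c`. [cite: FordMaynard2024PrimeSieves, §2.4] -/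
theorem eventually_not_typeII_of_sparse_rows {c θ ν B κ : ℝ} (hc0 : 0 < c) (hθ : 0 ≤ θ)
    (hθ1 : θ < 1) (hν : 0 < ν) (hc : 1 - c < θ + ν) (hκ : 1 - c < κ) (hθκ : θ < κ)
    (hB : 1 < B) :
    ∀ᶠ x : ℝ in atTop, ∀ (a b : ℕ → ℝ) (A Q : Finset ℕ), (A.card : ℝ) ≤ x ^ (1 - c) →
      (∀ v : ℕ, x / 2 < (v : ℝ) → (v : ℝ) ≤ x → a v ≠ 0 → v ∈ A) →
      (∀ n, 0 ≤ b n) → (Q.card : ℝ) ≤ Real.log x ^ 2 →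
      (∀ p : ℕ, p.Prime → p ∉ Q → (x / 2) ^ θ < (p : ℝ) → (p : ℝ) ≤ x ^ κ →
        x / (4 * p) ≤ ∑ n ∈ (Icc 1 ⌊x⌋₊).filter
          (fun n : ℕ => x / 2 < (p * n : ℝ) ∧ (p * n : ℝ) ≤ x), b (p * n)) →
      ¬ TypeII (fun n : ℕ => a n - b n) x θ ν B := by
  obtain ⟨K, hK1, hK⟩ := exists_card_primes_Ioc_two_mul_ge
  have hK0 : 0 < K := by linarith
  -- the scale `M ≍ x^{e}` with `max(θ, 1 - c) < e < min(κ, θ + ν, 1)`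
  set g : ℝ := min (min (θ + ν) κ) 1 with hgdef
  have hgν : g ≤ θ + ν := (min_le_left _ _).trans (min_le_left _ _)
  have hgκ : g ≤ κ := (min_le_left _ _).trans (min_le_right _ _)
  have hg1 : g ≤ 1 := min_le_right _ _
  set l : ℝ := max θ (1 - c) with hldef
  have hlθ : θ ≤ l := le_max_left _ _
  have hlc : 1 - c ≤ l := le_max_right _ _
  have hlg : l < g :=
    max_lt (lt_min (lt_min (by linarith) hθκ) hθ1) (lt_min (lt_min hc hκ) (by linarith))
  set e : ℝ := (l + g) / 2 with hedef
  have hle : l < e := by rw [hedef]; linarith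
  have heg : e < g := by rw [hedef]; linarith
  have hce : 1 - c < e := by linarith
  have hθe : θ < e := by linarith
  have he0 : 0 < e := by linarith
  have he1 : e < 1 := by linarith
  have hδ : 0 < (e - (1 - c)) / 3 := by linarith
  have he4 : 0 < e / 4 := by linarith
  filter_upwards [eventually_ge_atTop (4 : ℝ),
    eventually_mul_rpow_le_rpow 6 (by linarith : e < θ + ν),
    eventually_mul_rpow_le_rpow 6 (by linarith : e < κ),
    eventually_mul_rpow_le_rpow 48 he1,
    eventually_mul_rpow_le_rpow (16 * K)
      (by linarith : (1 - c) + (e - (1 - c)) / 3 + (e - (1 - c)) / 3 < e),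
    (isLittleO_log_rpow_atTop hδ).bound one_pos,
    (isLittleO_log_rpow_atTop he4).bound one_pos,
    eventually_mul_rpow_le_rpow (4 * K) (by linarith : e / 4 + e / 4 + e / 4 < e),
    ((tendsto_rpow_atTop (by linarith : 0 < B - 1)).comp
      Real.tendsto_log_atTop).eventually_gt_atTop (8 * (4 * K))]
    with x hx4 e1 e1' e2 e3 elog elog2 e5 e4 a b A Q hA hcov hb0 hQ hbm hII
  rw [Real.rpow_one] at e2
  have hx0 : 0 < x := by linarith
  have hx1 : 1 ≤ x := by linarith
  have hlx : 0 ≤ Real.log x := Real.log_nonneg hx1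
  have hlogle : Real.log x ≤ x ^ ((e - (1 - c)) / 3) := by
    have := elog
    simp only [one_mul, Real.norm_eq_abs] at this
    rwa [abs_of_nonneg hlx, abs_of_nonneg (Real.rpow_nonneg hx0.le _)] at this
  have hlogle2 : Real.log x ≤ x ^ (e / 4) := by
    have := elog2
    simp only [one_mul, Real.norm_eq_abs] at this
    rwa [abs_of_nonneg hlx, abs_of_nonneg (Real.rpow_nonneg hx0.le _)] at this
  have e4' : 8 * (4 * K) < Real.log x ^ (B - 1) := by simpa using e4
  -- the scale and the primes
  set M : ℕ := ⌊x ^ e⌋₊ + 2 with hMdef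
  have hM2 : 2 ≤ M := by omega
  have hM2r : (2 : ℝ) ≤ M := by exact_mod_cast hM2
  have hMe : x ^ e < M := by
    have := Nat.lt_floor_add_one (x ^ e)
    push_cast [hMdef]
    linarith
  have hxe1 : 1 ≤ x ^ e := Real.one_le_rpow hx1 he0.le
  have hMle : (M : ℝ) ≤ 3 * x ^ e := by
    have h1 : (⌊x ^ e⌋₊ : ℝ) ≤ x ^ e := Nat.floor_le (Real.rpow_nonneg hx0.le _)
    push_cast [hMdef]
    linarith
  have hxθe : (x / 2) ^ θ ≤ x ^ e :=
    calc (x / 2) ^ θ ≤ x ^ θ := Real.rpow_le_rpow (by positivity) (by linarith) hθ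
      _ ≤ x ^ e := Real.rpow_le_rpow_of_exponent_le hx1 hθe.le
  set P : Finset ℕ := (Ioc M (2 * M)).filter Nat.Prime with hPdef
  set S : Finset ℕ := P.filter (fun p : ℕ => p ∉ Q) with hSdef
  have hSP : S ⊆ P := by rw [hSdef]; exact filter_subset _ _
  have hSprop : ∀ p ∈ S, p.Prime ∧ (M : ℝ) < p ∧ (x / 2) ^ θ < (p : ℝ) ∧
      (p : ℝ) ≤ x ^ (θ + ν) := by
    intro p hp
    have hp' := hSP hp
    rw [hPdef, mem_filter, mem_Ioc] at hp'
    obtain ⟨⟨hMp, hp2M⟩, hpr⟩ := hp'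
    have hMp' : (M : ℝ) < p := by exact_mod_cast hMp
    have hp2M' : (p : ℝ) ≤ 2 * M := by exact_mod_cast hp2M
    exact ⟨hpr, hMp', by linarith, by linarith⟩
  have hSQ : ∀ p ∈ S, p ∉ Q := fun p hp => by
    have := hp; rw [hSdef, Finset.mem_filter] at this; exact this.2
  -- row masses `≥ x/(8M)` on `S`
  have hmass : ∀ p ∈ S, x / (8 * M) ≤ ∑ n ∈ (Icc 1 ⌊x⌋₊).filter
      (fun n : ℕ => x / 2 < (p * n : ℝ) ∧ (p * n : ℝ) ≤ x), b (p * n) := by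
    intro p hp
    have hp2M : (p : ℝ) ≤ 2 * M := by
      have := hSP hp; rw [hPdef, mem_filter, mem_Ioc] at this; exact_mod_cast this.1.2
    obtain ⟨hpr, _, hθp, _⟩ := hSprop p hp
    have hp0 : (0 : ℝ) < p := by exact_mod_cast hpr.pos
    have : x / (8 * M) ≤ x / (4 * p) :=
      div_le_div_of_nonneg_left hx0.le (by positivity) (by linarith)
    have hpκ : (p : ℝ) ≤ x ^ κ := by linarith [hMle, e1']
    exact this.trans (hbm p hpr (hSQ p hp) hθp hpκ)
  have hmain := typeII_sparse_le_rows (by linarith) hx1 (by linarith : (1 : ℝ) < M) S A hSprop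
    hcov hb0 (by positivity : (0 : ℝ) ≤ x / (8 * M)) hmass hII
  -- lower bounds
  have hL : Real.log x / Real.log M ≤ 2 * Real.log x := by
    have hlogM : Real.log 2 ≤ Real.log M := Real.log_le_log two_pos hM2r
    have hl2 := Real.log_two_gt_d9
    rw [div_le_iff₀ (by linarith)]
    nlinarith
  have hcardP := hK M (by omega)
  have h2Mx : 2 * (M : ℝ) ≤ x := by linarith
  have hlog2M0 : 0 < Real.log (2 * M) := Real.log_pos (by linarith)
  have hlog2M : Real.log (2 * M) ≤ Real.log x := Real.log_le_log (by positivity) h2Mx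
  have hlx0 : 0 < Real.log x := by linarith
  -- `#S ≥ M/(2K log 2M)`
  have hl3 : Real.log x ^ 2 * (2 * K * Real.log (2 * M)) ≤ M := by
    have e5' : 4 * K * (x ^ (e / 4) * x ^ (e / 4) * x ^ (e / 4)) ≤ x ^ e := by
      rw [← Real.rpow_add hx0, ← Real.rpow_add hx0]; exact e5
    exact sq_mul_le_of_cube_le hK0.le hlog2M0.le hlog2M hlogle2 e5' hMe.le
  have hcardS : (M : ℝ) / (2 * K * Real.log (2 * M)) ≤ S.card := by
    rw [hSdef, hPdef]
    exact div_le_card_filter_not_mem hK0 hlog2M0 hcardP hQ hl3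
  -- `#A · L ≤ 2 x^{1-c} log x ≤ M/(4K log 2M) ≤ #S/2`
  have hAL : (A.card : ℝ) * (Real.log x / Real.log M) ≤ x ^ (1 - c) * (2 * Real.log x) :=
    mul_le_mul hA hL (div_nonneg hlx (Real.log_nonneg (by linarith))) (Real.rpow_nonneg hx0.le _)
  have hAL2 : x ^ (1 - c) * (2 * Real.log x) ≤ (M : ℝ) / (4 * K * Real.log (2 * M)) :=
    rpow_mul_log_le_div_log hx0 hK0 hlog2M0 hlogle (hlog2M.trans hlogle) e3 hMe.le
  have hhalf : (M : ℝ) / (4 * K * Real.log (2 * M)) =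
      (M : ℝ) / (2 * K * Real.log (2 * M)) / 2 := by ring
  have hSA : (S.card : ℝ) / 2 ≤ S.card - A.card * (Real.log x / Real.log M) := by
    linarith
  -- `#S/2 · x/(8M) ≥ x/(32 K log x)`
  have hTlow : x / (8 * (4 * K) * Real.log x) ≤ (S.card : ℝ) / 2 * (x / (8 * M)) :=
    div_log_le_half_mul_div hx0 hK0 (by positivity) hlx0 hlog2M0 hlog2M hcardS
  have hmono : (S.card : ℝ) / 2 * (x / (8 * M)) ≤
      (S.card - A.card * (Real.log x / Real.log M)) * (x / (8 * M)) :=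
    mul_le_mul_of_nonneg_right hSA (by positivity)
  have hfin := div_log_rpow_lt (by positivity : 0 < 4 * K) (by linarith) e4'
  linarith

/-- **Corollary: the `(n, q) = 1` twist** — the exceptional set is the set of prime divisors of
`0 < q ≤ x²`. [cite: FordMaynard2024PrimeSieves, §4.2] -/
theorem eventually_not_typeII_of_sparse_rows_coprime {c θ ν B κ : ℝ} (hc0 : 0 < c) (hθ : 0 ≤ θ)
    (hθ1 : θ < 1) (hν : 0 < ν) (hc : 1 - c < θ + ν) (hκ : 1 - c < κ) (hθκ : θ < κ)
    (hB : 1 < B) :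
    ∀ᶠ x : ℝ in atTop, ∀ (a b : ℕ → ℝ) (A : Finset ℕ) (q : ℕ), (A.card : ℝ) ≤ x ^ (1 - c) →
      (∀ v : ℕ, x / 2 < (v : ℝ) → (v : ℝ) ≤ x → a v ≠ 0 → v ∈ A) →
      (∀ n, 0 ≤ b n) → 0 < q → (q : ℝ) ≤ x ^ 2 →
      (∀ p : ℕ, p.Prime → ¬ p ∣ q → (x / 2) ^ θ < (p : ℝ) → (p : ℝ) ≤ x ^ κ →
        x / (4 * p) ≤ ∑ n ∈ (Icc 1 ⌊x⌋₊).filter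
          (fun n : ℕ => x / 2 < (p * n : ℝ) ∧ (p * n : ℝ) ≤ x), b (p * n)) →
      ¬ TypeII (fun n : ℕ => a n - b n) x θ ν B := by
  filter_upwards [eventually_not_typeII_of_sparse_rows hc0 hθ hθ1 hν hc hκ hθκ hB,
    eventually_ge_atTop (Real.exp 6)] with x hx hx6 a b A q hA hcov hb0 hq hqx hbm
  refine hx a b A q.primeFactors hA hcov hb0 (card_primeFactors_le_log_sq hx6 hq hqx) ?_
  intro p hpr hpQ
  exact hbm p hpr (fun hd => hpQ (Nat.mem_primeFactors.mpr ⟨hpr, hd, hq.ne'⟩))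

end Summit.Parity.BatemanHorn.Theorems

end
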